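import Summits.CriticalPhenomena.PercolationContinuityZ3.Theorems.PercNearOneGluingNoHeavyLowerTailSunflowerGoodCoordinate
import HarnessLib

/-!
# `NoHeavyLowerTail` (crux stmt-CriticalPhenomena-4575), abstract sunflower cubic: the two new ONE-POINT CERTIFICATE classes —
# ★ at a PETAL-COMPLETING coordinate (unconditional) and (MZ) at a coordinate whose UPPER section uses at most one petal value

Support file (seat `prim-ineq-gen-2` gen 24; `--supports stmt-CriticalPhenomena-4575`; companion of `…SunflowerRestrictionSingleton` (p222183),
`…SunflowerRestrictionNoLiftedRainbow` (p226120), `…SunflowerRestrictionExchange` (p226314), `…SunflowerGoodCoordinate`).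
Memo: run/shared/lean/prim/prim-ineq-gen-2/ONE-POINT-SCAN-GEN24.md.  Nothing is asserted about the crux; no `sorry`.

SETTING.  `F : Sunflower α` (monotone `lab : 2^α → M₃`), a sub-cube `2^W`, a coordinate `e ∉ W`, the lower section `φ X = lab X` and the
upper section `ψ X = lab (insert e X)` on `2^W`; `nested W (s6H ∘ lab) = F.ZP W ∅ ∅ ∅` is the partition functional of the sub-cube and
`nested (insert e W) (s6H ∘ lab) = 3 · nested W (s6H (ψ·) (φ·) (φ·))` (`Sunflower.nested_insert_eq`).  The one-point CODE of a block `X ⊆ W` is the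
pair `(φX, ψX)` (`φX ≤ ψX` in `M₃`; 12 codes).  Both results below were found by a COMPLETE exact LP scan over all `2¹²` code classes
(kit j165309, memo §2): they are two of the maximal classes admitting a pointwise certificate "symmetrised kernel ≥ spectator × antipodal-Gladkov rows",
and in both the Gladkov weight `3` is rigid.

MAIN RESULTS (this work).
* `Sunflower.nested_insert_nonneg_of_petalCompleting`, `Sunflower.ZH_nonneg_of_petalCompleting` — **★ at a PETAL-COMPLETING coordinate, unconditionally**:
  if `lab (insert e X) = ⊤` for every PETAL set `X ⊆ W` (`lab X ∈ {1,2,3}`), then `0 ≤ 3·Σ_X Σ_{S⊔T=W∖X} kk(φS, φT) ≤ nested (insert e W) (s6H ∘ lab)`;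
  whole-type form: if some coordinate `e` completes every petal set avoiding it into the kernel, then `0 ≤ F.ZH`.  The lower section is ARBITRARY and the
  upper section is arbitrary on the bottom sets of the lower one, so the class contains `φ ⊕ (completer)` for every sunflower `φ` — e.g. over the doubled
  co-star, which has no good coordinate — and is not contained in the intersecting / centred / disjunctive-petal / pierced-pair / three-block classes.
  Kernel fact: the symmetrisation of `s6H(x₁,y₀,z₀) − kk(y₀,z₀)` over the six block orders is `≥ 0` on petal-completing codes (`pcSymm_nonneg_code`, `decide`).
* `Sunflower.ZP_le_ZP_insert_of_upper_le_one_petal` — **(MZ) at `e` whenever the UPPER section uses at most one petal value** (`lab (insert e X) ∈ {0, k, ⊤}`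
  for all `X ⊆ W`), quantitatively `3·Σ s6H(ψ,φ,φ) − Σ s6H(φ,φ,φ) ≥ 3·Σ_X [ψX ∈ {0,⊤}]·Σ kk(φS, φT) ≥ 0` (`three_nested_upper_sub_ge`; kernel fact
  `ocSymm_nonneg_code`).  Not contained in the three mechanisms of `…SunflowerGoodCoordinate` (the lower section may use all three petals, so lifted rainbows
  `(k; i, j)` occur; two disjoint entries `0 → k` or exits `i → ⊤, j → ⊤` occur; `lab {e}` may be `0`); it strictly contains the non-bottom-singleton case.
COROLLARIES: `Sunflower.goodCoordinate_of_criteria'` (five mechanisms: (A), (NLR), (H*), upper-one-petal, petal-completing — the last gives `0 ≤ ZP W` outright, a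
fortiori the disjunction) and the class theorem `Sunflower.ZH_nonneg_of_forall_upper_le_one_petal`.
-/

namespace Summit.CriticalPhenomena.PercolationContinuityZ3.Theorems.SunflowerPartition

open Finset

/-! ## The kernel of the comparison and its pointwise nonnegativity after symmetrisation -/

/-- The comparison kernel at an upper-one-petal coordinate, on code triples `(x₀,x₁), (y₀,y₁), (z₀,z₁)` (lower/upper labels of the three blocks;
the upper labels of the second and third block are not used): `3·s6H x₁ y₀ z₀ − s6H x₀ y₀ z₀ − 3·[x₁ ∈ {0,⊤}]·kk y₀ z₀`. [this work] -/
def ocKernel (x0 x1 y0 _y1 z0 _z1 : Fin 5) : ℤ :=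
  3 * s6H x1 y0 z0 - s6H x0 y0 z0 - 3 * ((if x1 = 0 ∨ x1 = 4 then (1 : ℤ) else 0) * kk y0 z0)

/-- Symmetrisation of `ocKernel` over the six block orders. [this work] -/
def ocSymm (x0 x1 y0 y1 z0 z1 : Fin 5) : ℤ :=
  ocKernel x0 x1 y0 y1 z0 z1 + ocKernel x0 x1 z0 z1 y0 y1 + ocKernel y0 y1 x0 x1 z0 z1
    + ocKernel y0 y1 z0 z1 x0 x1 + ocKernel z0 z1 x0 x1 y0 y1 + ocKernel z0 z1 y0 y1 x0 x1

/-- Admissible one-point code at an upper-one-petal coordinate with petal value `k` (Boolean test): `x₀ ≤ x₁` in `M₃` and `x₁ ∈ {0, k, ⊤}`.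
[this work] -/
def upperCode (k x0 x1 : Fin 5) : Bool := (x0 = x1 || x0 = 0 || x1 = 4) && (x1 = 0 || x1 = k || x1 = 4)

/-- From the two propositional conditions to the Boolean code test. [this work] -/
theorem upperCode_of_conds : ∀ k x0 x1 : Fin 5, (x0 = x1 ∨ x0 = 0 ∨ x1 = 4) → (x1 = 0 ∨ x1 = k ∨ x1 = 4) → upperCode k x0 x1 = true := by
  decide

/-- **Pointwise nonnegativity of the symmetrised kernel** on admissible code triples, for every value `k`
(`decide` over the `5⁷` tuples `(k, x₀, x₁, y₀, y₁, z₀, z₁)`). [this work] -/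
theorem ocSymm_nonneg_code : ∀ k x0 x1 y0 y1 z0 z1 : Fin 5,
    upperCode k x0 x1 = true → upperCode k y0 y1 = true → upperCode k z0 z1 = true → 0 ≤ ocSymm x0 x1 y0 y1 z0 z1 := by
  decide

/-- **Pointwise nonnegativity of the symmetrised kernel**, propositional hypotheses. [this work] -/
theorem ocSymm_nonneg (k x0 x1 y0 y1 z0 z1 : Fin 5)
    (hx : x0 = x1 ∨ x0 = 0 ∨ x1 = 4) (hx1 : x1 = 0 ∨ x1 = k ∨ x1 = 4) (hy : y0 = y1 ∨ y0 = 0 ∨ y1 = 4) (hy1 : y1 = 0 ∨ y1 = k ∨ y1 = 4)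
    (hz : z0 = z1 ∨ z0 = 0 ∨ z1 = 4) (hz1 : z1 = 0 ∨ z1 = k ∨ z1 = 4) : 0 ≤ ocSymm x0 x1 y0 y1 z0 z1 :=
  ocSymm_nonneg_code k x0 x1 y0 y1 z0 z1 (upperCode_of_conds k x0 x1 hx hx1) (upperCode_of_conds k y0 y1 hy hy1)
    (upperCode_of_conds k z0 z1 hz hz1)

/-- The comparison kernel at a petal-completing coordinate: `s6H x₁ y₀ z₀ − kk y₀ z₀` (only the upper label of the first block and the lower
labels of the other two are used). [this work] -/
def pcKernel (_x0 x1 y0 _y1 z0 _z1 : Fin 5) : ℤ := s6H x1 y0 z0 - kk y0 z0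

/-- Symmetrisation of `pcKernel` over the six block orders. [this work] -/
def pcSymm (x0 x1 y0 y1 z0 z1 : Fin 5) : ℤ :=
  pcKernel x0 x1 y0 y1 z0 z1 + pcKernel x0 x1 z0 z1 y0 y1 + pcKernel y0 y1 x0 x1 z0 z1
    + pcKernel y0 y1 z0 z1 x0 x1 + pcKernel z0 z1 x0 x1 y0 y1 + pcKernel z0 z1 y0 y1 x0 x1

/-- Admissible one-point code at a petal-completing coordinate (Boolean test): `x₀ ≤ x₁` in `M₃` and `x₀ ∈ {1,2,3} ⇒ x₁ = ⊤`. [this work] -/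
def pcCode (x0 x1 : Fin 5) : Bool := (x0 = x1 || x0 = 0 || x1 = 4) && (x0 = 0 || x0 = 4 || x1 = 4)

/-- From the propositional conditions to the Boolean code test. [this work] -/
theorem pcCode_of_conds : ∀ x0 x1 : Fin 5, (x0 = x1 ∨ x0 = 0 ∨ x1 = 4) → (x0 = 0 ∨ x0 = 4 ∨ x1 = 4) → pcCode x0 x1 = true := by
  decide

/-- **Pointwise nonnegativity of the symmetrised petal-completing kernel** (`decide` over the `5⁶` tuples). [this work] -/
theorem pcSymm_nonneg_code : ∀ x0 x1 y0 y1 z0 z1 : Fin 5,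
    pcCode x0 x1 = true → pcCode y0 y1 = true → pcCode z0 z1 = true → 0 ≤ pcSymm x0 x1 y0 y1 z0 z1 := by
  decide

variable {α : Type*} [DecidableEq α]

/-! ## Symmetrisation of nested sums of a kernel of the block CODES -/

/-- Six times the nested sum of a code kernel equals the nested sum of its symmetrisation (block symmetries `nested_swap12/23`). [this work] -/
theorem six_mul_nested_codes_eq (W : Finset α) (L₀ L₁ : Finset α → Fin 5) (g : Fin 5 → Fin 5 → Fin 5 → Fin 5 → Fin 5 → Fin 5 → ℤ) :
    6 * nested W (fun X S T => g (L₀ X) (L₁ X) (L₀ S) (L₁ S) (L₀ T) (L₁ T))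
      = nested W (fun X S T => g (L₀ X) (L₁ X) (L₀ S) (L₁ S) (L₀ T) (L₁ T) + g (L₀ X) (L₁ X) (L₀ T) (L₁ T) (L₀ S) (L₁ S)
          + g (L₀ S) (L₁ S) (L₀ X) (L₁ X) (L₀ T) (L₁ T) + g (L₀ S) (L₁ S) (L₀ T) (L₁ T) (L₀ X) (L₁ X)
          + g (L₀ T) (L₁ T) (L₀ X) (L₁ X) (L₀ S) (L₁ S) + g (L₀ T) (L₁ T) (L₀ S) (L₁ S) (L₀ X) (L₁ X)) := by
  set G : Finset α → Finset α → Finset α → ℤ := fun X S T => g (L₀ X) (L₁ X) (L₀ S) (L₁ S) (L₀ T) (L₁ T) with hG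
  have e1 : nested W G = nested W (fun X S T => G X T S) := nested_swap23 W G
  have e2 : nested W G = nested W (fun X S T => G S X T) := nested_swap12 W G
  have e3 : nested W G = nested W (fun X S T => G S T X) :=
    e1.trans (nested_swap12 W (fun X S T => G X T S))
  have e4 : nested W G = nested W (fun X S T => G T X S) :=
    e2.trans (nested_swap23 W (fun X S T => G S X T))
  have e5 : nested W G = nested W (fun X S T => G T S X) :=
    e3.trans (nested_swap23 W (fun X S T => G S T X))
  have key : nested W (fun X S T => G X S T + G X T S + G S X T + G S T X + G T X S + G T S X)
      = nested W G + nested W (fun X S T => G X T S) + nested W (fun X S T => G S X T)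
        + nested W (fun X S T => G S T X) + nested W (fun X S T => G T X S) + nested W (fun X S T => G T S X) := by
    unfold nested
    simp only [sum_add_distrib]
  show 6 * nested W G = nested W (fun X S T => G X S T + G X T S + G S X T + G S T X + G T X S + G T S X)
  rw [key, ← e1, ← e2, ← e3, ← e4, ← e5]
  ring

/-! ## Spectator Gladkov with weights read on the upper section -/

/-- **Spectator Gladkov, upper-section weights**: for nonnegative weights `a` of the UPPER label of the spectator block,
`0 ≤ Σ_X a(lab (insert e X)) · Σ_{S ⊆ W∖X} kk (lab S) (lab ((W∖X)∖S))`. [this work] -/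
theorem Sunflower.spectator_upper_gladkov_nonneg (F : Sunflower α) (W : Finset α) (e : α) (a : Fin 5 → ℤ) (ha : ∀ x, 0 ≤ a x) :
    0 ≤ nested W (fun X S T => a (F.lab (insert e X)) * kk (F.lab S) (F.lab T)) := by
  unfold nested
  refine sum_nonneg fun X _ => ?_
  rw [← mul_sum]
  exact mul_nonneg (ha _) (F.antipodal_gladkov (W \ X))

/-! ## The comparison at an upper-one-petal coordinate -/

namespace Sunflower

variable (F : Sunflower α)

/-- **★ at a petal-completing coordinate, nested form** (this work): if `lab (insert e X) = ⊤` for every petal set `X ⊆ W`, then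
`3 · Σ_X Σ_{S ⊔ T = W∖X} kk (φS) (φT) ≤ 3 · Σ s6H (ψX) (φS) (φT) = nested (insert e W) (s6H ∘ lab)` (`e ∉ W`), and the left side is `≥ 0`. -/
theorem three_gladkov_le_nested_insert_of_petalCompleting (W : Finset α) (e : α) (he : e ∉ W)
    (hpc : ∀ X, X ⊆ W → F.lab X ≠ 0 → F.lab X ≠ 4 → F.lab (insert e X) = 4) :
    3 * nested W (fun _ S T => kk (F.lab S) (F.lab T))
      ≤ nested (insert e W) (fun X S T => s6H (F.lab X) (F.lab S) (F.lab T)) := by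
  rw [F.nested_insert_eq W e he]
  have hdiff : nested W (fun X S T => s6H (F.lab (insert e X)) (F.lab S) (F.lab T)) - nested W (fun _ S T => kk (F.lab S) (F.lab T))
      = nested W (fun X S T => pcKernel (F.lab X) (F.lab (insert e X)) (F.lab S) (F.lab (insert e S)) (F.lab T) (F.lab (insert e T))) := by
    unfold nested pcKernel
    simp only [← sum_sub_distrib]
  have hsym := six_mul_nested_codes_eq W F.lab (fun X => F.lab (insert e X)) pcKernel
  have hpos : 0 ≤ nested W (fun X S T =>
      pcKernel (F.lab X) (F.lab (insert e X)) (F.lab S) (F.lab (insert e S)) (F.lab T) (F.lab (insert e T))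
        + pcKernel (F.lab X) (F.lab (insert e X)) (F.lab T) (F.lab (insert e T)) (F.lab S) (F.lab (insert e S))
        + pcKernel (F.lab S) (F.lab (insert e S)) (F.lab X) (F.lab (insert e X)) (F.lab T) (F.lab (insert e T))
        + pcKernel (F.lab S) (F.lab (insert e S)) (F.lab T) (F.lab (insert e T)) (F.lab X) (F.lab (insert e X))
        + pcKernel (F.lab T) (F.lab (insert e T)) (F.lab X) (F.lab (insert e X)) (F.lab S) (F.lab (insert e S))
        + pcKernel (F.lab T) (F.lab (insert e T)) (F.lab S) (F.lab (insert e S)) (F.lab X) (F.lab (insert e X))) := by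
    unfold nested
    refine sum_nonneg fun X hX => sum_nonneg fun S hS => ?_
    have hXW : X ⊆ W := mem_powerset.1 hX
    have hSW : S ⊆ W := (mem_powerset.1 hS).trans sdiff_subset
    have hTW : (W \ X) \ S ⊆ W := sdiff_subset.trans sdiff_subset
    have cond : ∀ Y, Y ⊆ W → (F.lab Y = 0 ∨ F.lab Y = 4 ∨ F.lab (insert e Y) = 4) := by
      intro Y hY
      by_cases h0 : F.lab Y = 0
      · exact Or.inl h0
      by_cases h4 : F.lab Y = 4
      · exact Or.inr (Or.inl h4)
      exact Or.inr (Or.inr (hpc Y hY h0 h4))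
    exact pcSymm_nonneg_code _ _ _ _ _ _
      (pcCode_of_conds _ _ (F.lab_mono (subset_insert e X)) (cond X hXW))
      (pcCode_of_conds _ _ (F.lab_mono (subset_insert e S)) (cond S hSW))
      (pcCode_of_conds _ _ (F.lab_mono (subset_insert e _)) (cond _ hTW))
  have h6 : 0 ≤ 6 * nested W (fun X S T =>
      pcKernel (F.lab X) (F.lab (insert e X)) (F.lab S) (F.lab (insert e S)) (F.lab T) (F.lab (insert e T))) := by
    rw [hsym]; exact hpos
  linarith

/-- **★ on a sub-cube with a petal-completing coordinate** (this work): `e ∉ W`, `lab (insert e X) = ⊤` for every petal set `X ⊆ W` ⟹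
`0 ≤ nested (insert e W) (s6H ∘ lab)`. -/
theorem nested_insert_nonneg_of_petalCompleting (W : Finset α) (e : α) (he : e ∉ W)
    (hpc : ∀ X, X ⊆ W → F.lab X ≠ 0 → F.lab X ≠ 4 → F.lab (insert e X) = 4) :
    0 ≤ nested (insert e W) (fun X S T => s6H (F.lab X) (F.lab S) (F.lab T)) := by
  have h1 := F.three_gladkov_le_nested_insert_of_petalCompleting W e he hpc
  have h2 := F.spectator_gladkov_nonneg W (fun _ => (1 : ℤ)) (fun _ => zero_le_one)
  have h3 : nested W (fun X S T => (fun _ => (1 : ℤ)) (F.lab X) * kk (F.lab S) (F.lab T)) = nested W (fun _ S T => kk (F.lab S) (F.lab T)) := by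
    unfold nested; simp only [one_mul]
  linarith

/-- `RestrictionMonotonicity` format (this work): `e ∉ W`, petal-completing at `e` ⟹ `0 ≤ F.ZP (insert e W) ∅ ∅ ∅`. -/
theorem ZP_insert_nonneg_of_petalCompleting (W : Finset α) (e : α) (he : e ∉ W)
    (hpc : ∀ X, X ⊆ W → F.lab X ≠ 0 → F.lab X ≠ 4 → F.lab (insert e X) = 4) :
    0 ≤ F.ZP (insert e W) ∅ ∅ ∅ := by
  rw [F.ZP_empty_eq_nested]
  exact F.nested_insert_nonneg_of_petalCompleting W e he hpc

/-- **Class theorem: ★ for every sunflower with a petal-completing coordinate** (this work): if some `e` satisfies `lab (insert e X) = ⊤` for every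
petal set `X` avoiding `e`, then `0 ≤ ZH` — unconditionally (no induction on minors). -/
theorem ZH_nonneg_of_petalCompleting {β : Type*} [Fintype β] [DecidableEq β] (F : Sunflower β) (e : β)
    (hpc : ∀ X : Finset β, e ∉ X → F.lab X ≠ 0 → F.lab X ≠ 4 → F.lab (insert e X) = 4) : 0 ≤ F.ZH := by
  rw [← F.ZP_univ_empty, ← insert_erase (mem_univ e)]
  exact F.ZP_insert_nonneg_of_petalCompleting (univ.erase e) e (notMem_erase e univ)
    fun X hX => hpc X fun h => notMem_erase e univ (hX h)

/-- **Quantitative comparison** (this work): if `lab (insert e X) ∈ {0, k, ⊤}` for all `X ⊆ W`, then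
`3·Σ s6H(ψ,φ,φ) − Σ s6H(φ,φ,φ) ≥ 3·Σ_X [ψX ∈ {0,⊤}]·Σ kk(φS, φT)` (nested sums over ordered 3-partitions of `W`). -/
theorem three_nested_upper_sub_ge (W : Finset α) (e : α) (k : Fin 5)
    (hone : ∀ X, X ⊆ W → (F.lab (insert e X) = 0 ∨ F.lab (insert e X) = k ∨ F.lab (insert e X) = 4)) :
    3 * nested W (fun X S T => (if F.lab (insert e X) = 0 ∨ F.lab (insert e X) = 4 then (1 : ℤ) else 0) * kk (F.lab S) (F.lab T))
      ≤ 3 * nested W (fun X S T => s6H (F.lab (insert e X)) (F.lab S) (F.lab T))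
        - nested W (fun X S T => s6H (F.lab X) (F.lab S) (F.lab T)) := by
  -- the difference is the nested sum of `ocKernel` of the codes
  have hdiff : 3 * nested W (fun X S T => s6H (F.lab (insert e X)) (F.lab S) (F.lab T))
        - nested W (fun X S T => s6H (F.lab X) (F.lab S) (F.lab T))
        - 3 * nested W (fun X S T => (if F.lab (insert e X) = 0 ∨ F.lab (insert e X) = 4 then (1 : ℤ) else 0) * kk (F.lab S) (F.lab T))
      = nested W (fun X S T => ocKernel (F.lab X) (F.lab (insert e X)) (F.lab S) (F.lab (insert e S)) (F.lab T) (F.lab (insert e T))) := by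
    unfold nested ocKernel
    simp only [mul_sum, ← sum_sub_distrib]
  -- six times it is the nested sum of the symmetrised kernel, pointwise nonnegative on admissible codes
  have hsym := six_mul_nested_codes_eq W F.lab (fun X => F.lab (insert e X)) ocKernel
  have hpos : 0 ≤ nested W (fun X S T =>
      ocKernel (F.lab X) (F.lab (insert e X)) (F.lab S) (F.lab (insert e S)) (F.lab T) (F.lab (insert e T))
        + ocKernel (F.lab X) (F.lab (insert e X)) (F.lab T) (F.lab (insert e T)) (F.lab S) (F.lab (insert e S))
        + ocKernel (F.lab S) (F.lab (insert e S)) (F.lab X) (F.lab (insert e X)) (F.lab T) (F.lab (insert e T))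
        + ocKernel (F.lab S) (F.lab (insert e S)) (F.lab T) (F.lab (insert e T)) (F.lab X) (F.lab (insert e X))
        + ocKernel (F.lab T) (F.lab (insert e T)) (F.lab X) (F.lab (insert e X)) (F.lab S) (F.lab (insert e S))
        + ocKernel (F.lab T) (F.lab (insert e T)) (F.lab S) (F.lab (insert e S)) (F.lab X) (F.lab (insert e X))) := by
    unfold nested
    refine sum_nonneg fun X hX => sum_nonneg fun S hS => ?_
    have hXW : X ⊆ W := mem_powerset.1 hX
    have hSW : S ⊆ W := (mem_powerset.1 hS).trans sdiff_subset
    have hTW : (W \ X) \ S ⊆ W := sdiff_subset.trans sdiff_subset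
    exact ocSymm_nonneg k _ _ _ _ _ _ (F.lab_mono (subset_insert e X)) (hone X hXW) (F.lab_mono (subset_insert e S)) (hone S hSW)
      (F.lab_mono (subset_insert e _)) (hone _ hTW)
  have h6 : 0 ≤ 6 * nested W (fun X S T =>
      ocKernel (F.lab X) (F.lab (insert e X)) (F.lab S) (F.lab (insert e S)) (F.lab T) (F.lab (insert e T))) := by
    rw [hsym]; exact hpos
  linarith

/-- **Restriction monotonicity at an upper-one-petal coordinate, nested form** (this work): if `e ∉ W` and `lab (insert e X) ∈ {0, k, ⊤}`
for all `X ⊆ W`, then `nested W (s6H ∘ lab) ≤ nested (insert e W) (s6H ∘ lab)`. -/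
theorem nested_le_nested_insert_of_upper_le_one_petal (W : Finset α) (e : α) (he : e ∉ W) (k : Fin 5)
    (hone : ∀ X, X ⊆ W → (F.lab (insert e X) = 0 ∨ F.lab (insert e X) = k ∨ F.lab (insert e X) = 4)) :
    nested W (fun X S T => s6H (F.lab X) (F.lab S) (F.lab T))
      ≤ nested (insert e W) (fun X S T => s6H (F.lab X) (F.lab S) (F.lab T)) := by
  rw [F.nested_insert_eq W e he]
  have h1 := F.three_nested_upper_sub_ge W e k hone
  have h2 := F.spectator_upper_gladkov_nonneg W e
    (fun x => if x = 0 ∨ x = 4 then (1 : ℤ) else 0) (fun x => by split_ifs <;> norm_num)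
  linarith

/-- **`RestrictionMonotonicity` holds at every coordinate whose upper section uses at most one petal value** (this work):
`e ∉ W`, `lab (insert e X) ∈ {0, k, ⊤}` for all `X ⊆ W` ⟹ `F.ZP W ∅ ∅ ∅ ≤ F.ZP (insert e W) ∅ ∅ ∅`. -/
theorem ZP_le_ZP_insert_of_upper_le_one_petal (W : Finset α) (e : α) (he : e ∉ W) (k : Fin 5)
    (hone : ∀ X, X ⊆ W → (F.lab (insert e X) = 0 ∨ F.lab (insert e X) = k ∨ F.lab (insert e X) = 4)) :
    F.ZP W ∅ ∅ ∅ ≤ F.ZP (insert e W) ∅ ∅ ∅ := by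
  rw [F.ZP_empty_eq_nested, F.ZP_empty_eq_nested]
  exact F.nested_le_nested_insert_of_upper_le_one_petal W e he k hone

/-- **Class theorem** (this work): if EVERY coordinate `e ∈ W` has an upper section with at most one petal value on the sets avoiding `e`
(`∀ e, ∃ k, ∀ X ⊆ W ∖ {e}, lab (insert e X) ∈ {0, k, ⊤}`), then `0 ≤ F.ZP W ∅ ∅ ∅` (induct on `W` from `ZP ∅ ∅ ∅ ∅ = 0`; the hypothesis
is inherited by sub-cubes). -/
theorem ZP_nonneg_of_forall_upper_le_one_petal (W : Finset α)
    (hW : ∀ e ∈ W, ∃ k : Fin 5, ∀ X, X ⊆ W → e ∉ X → (F.lab (insert e X) = 0 ∨ F.lab (insert e X) = k ∨ F.lab (insert e X) = 4)) :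
    0 ≤ F.ZP W ∅ ∅ ∅ := by
  induction W using Finset.induction_on with
  | empty => rw [F.ZP_empty]
  | insert e W' he ih =>
    have h1 : 0 ≤ F.ZP W' ∅ ∅ ∅ := by
      refine ih fun x hx => ?_
      obtain ⟨k, hk⟩ := hW x (mem_insert_of_mem hx)
      exact ⟨k, fun X hX hxX => hk X (hX.trans (subset_insert e W')) hxX⟩
    obtain ⟨k, hk⟩ := hW e (mem_insert_self e W')
    exact le_trans h1 (F.ZP_le_ZP_insert_of_upper_le_one_petal W' e he k
      fun X hX => hk X (hX.trans (subset_insert e W')) fun h => he (hX h))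

/-- Whole-type form (this work): if for every coordinate `e` the sets containing `e` avoid two of the three petals
(`∃ k, ∀ X, lab (insert e X) ∈ {0, k, ⊤}`), then `0 ≤ ZH` — the partition lemma ★ for this class. -/
theorem ZH_nonneg_of_forall_upper_le_one_petal {β : Type*} [Fintype β] [DecidableEq β] (F : Sunflower β)
    (h : ∀ e : β, ∃ k : Fin 5, ∀ X : Finset β, F.lab (insert e X) = 0 ∨ F.lab (insert e X) = k ∨ F.lab (insert e X) = 4) :
    0 ≤ F.ZH := by
  rw [← F.ZP_univ_empty]
  refine F.ZP_nonneg_of_forall_upper_le_one_petal univ fun e _ => ?_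
  obtain ⟨k, hk⟩ := h e
  exact ⟨k, fun X _ _ => hk X⟩

end Sunflower

/-! ## The extended good-coordinate criterion -/

/-- **Four mechanisms for a good coordinate** (this work, extending `Sunflower.goodCoordinate_of_criteria` of `…SunflowerGoodCoordinate` by the
upper-one-petal mechanism; petal-completing coordinates are handled by `Sunflower.ZP_nonneg_of_petalCompleting_mem` below): the disjunction required by `partitionLemmaH_of_goodCoordinates` holds at `e ∈ W` whenever (A) `lab {e} ≠ 0`, or (NLR)
`e` creates no lifted rainbow on `2^(W.erase e)`, or (H*) no two disjoint same-direction petal transitions under `e`, or (U1) the upper section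
`X ↦ lab (insert e X)` takes at most one petal value on `2^(W.erase e)`. -/
theorem Sunflower.goodCoordinate_of_criteria' {β : Type*} [Fintype β] [DecidableEq β] (F : Sunflower β) (W : Finset β) (e : β) (he : e ∈ W)
    (h : F.lab {e} ≠ 0 ∨
      (∀ X ∈ (W.erase e).powerset, ∀ S ∈ ((W.erase e) \ X).powerset,
          triP (F.lab (insert e X)) (F.lab S) (F.lab (((W.erase e) \ X) \ S)) = 0) ∨
      (∀ X ∈ (W.erase e).powerset, ∀ S ∈ ((W.erase e) \ X).powerset,
        ¬ (((F.lab X ≠ 0 ∧ F.lab X ≠ 4) ∧ F.lab (insert e X) = 4 ∧ (F.lab S ≠ 0 ∧ F.lab S ≠ 4) ∧ F.lab (insert e S) = 4) ∨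
           (F.lab X = 0 ∧ (F.lab (insert e X) ≠ 0 ∧ F.lab (insert e X) ≠ 4) ∧ F.lab S = 0 ∧ (F.lab (insert e S) ≠ 0 ∧ F.lab (insert e S) ≠ 4)))) ∨
      (∃ k : Fin 5, ∀ X, X ⊆ W.erase e → (F.lab (insert e X) = 0 ∨ F.lab (insert e X) = k ∨ F.lab (insert e X) = 4))) :
    F.ZP (W.erase e) ∅ ∅ ∅ ≤ F.ZP W ∅ ∅ ∅ ∨
      2 * F.ZP (W.erase e) ∅ ∅ ∅ + (F.con e).ZP (W.erase e) ∅ ∅ ∅ ≤ F.ZP W ∅ ∅ ∅ := by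
  rcases h with hA | hN | hX | ⟨k, hk⟩
  · exact F.goodCoordinate_of_criteria W e he (Or.inl hA)
  · exact F.goodCoordinate_of_criteria W e he (Or.inr (Or.inl hN))
  · exact F.goodCoordinate_of_criteria W e he (Or.inr (Or.inr hX))
  · left
    have := F.ZP_le_ZP_insert_of_upper_le_one_petal (W.erase e) e (notMem_erase e W) k hk
    rwa [insert_erase he] at this

/-- **Petal-completing coordinates are good outright** (this work): at such an `e ∈ W` the partition functional of `W` itself is `≥ 0`, so the
good-coordinate induction of `partitionLemmaH_of_goodCoordinates` may simply stop there. -/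
theorem Sunflower.ZP_nonneg_of_petalCompleting_mem {β : Type*} [Fintype β] [DecidableEq β] (F : Sunflower β) (W : Finset β) (e : β) (he : e ∈ W)
    (hpc : ∀ X, X ⊆ W.erase e → F.lab X ≠ 0 → F.lab X ≠ 4 → F.lab (insert e X) = 4) : 0 ≤ F.ZP W ∅ ∅ ∅ := by
  have := F.ZP_insert_nonneg_of_petalCompleting (W.erase e) e (notMem_erase e W) hpc
  rwa [insert_erase he] at this

end Summit.CriticalPhenomena.PercolationContinuityZ3.Theorems.SunflowerPartition
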